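import Literature.NumberTheory.EllipticCurves.ComplexMultiplicationDeuringReduction
import Literature.NumberTheory.EllipticCurves.HasseElementary
import Mathlib.NumberTheory.JacobiSum.Basic
import Mathlib.NumberTheory.MulChar.Lemmas
import HarnessLib

/-!
# Deuring's `a_p = π + π̄` for `j = 0` (Gauss; Ireland–Rosen, Ch. 18 §3), proved

Sibling proof file of `Literature.NumberTheory.EllipticCurves.ComplexMultiplicationCoatesWiles`
(D-0014 append protocol; everything here is proved). It establishes the case `j(E) = 0`
(`K = ℚ(√-3)`, `d = -3`, `𝓞_K = ℤ[ω]`) of the named fact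
`Literature.NumberTheory.EllipticCurves.Deuring1941_frobeniusTrace_eq_add_conj` (Deuring 1941; Cox, *Primes of the form
x² + ny²*, Thm. 14.16: at a good prime `p` split in `K`, `a_p(E) = π + π̄` with `π ∈ 𝓞_K`,
`ππ̄ = p`) unconditionally:

* `Literature.NumberTheory.EllipticCurves.Deuring1941_frobeniusTrace_eq_add_conj_of_j_eq_zero` — for a globally minimal `W/ℚ`
  with `j(W) = 0` and a prime `p ∤ 6 Δ_W` with `-3` a square mod `p`, there is
  `π ∈ ℤ[ω] ⊂ ℂ` (`cmRing (-3)`) with `ππ̄ = p` and `a_p(W) = π + π̄` — literally the body of the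
  named fact under `W.j = 0`.

Cox points out (§14.C, (14.17) and the paragraph after it, PDF pp. 323–324) that for `j = 0`
Deuring's theorem is Gauss's count of points on `x³ = y³ + 1`, i.e. on `y² = 4x³ − 27`
(Ireland–Rosen, *A Classical Introduction to Modern Number Theory*, Ch. 18 §3, Thm. 4, PDF
p. 299: for `p ≡ 1 (3)`, `p ∤ 6D`, `#E(𝔽_p)` for `E : y² = x³ + D` is `p + 1` plus a sum of two
conjugate terms `unit · π`, `π ≡ 2 (3)` a prime of `ℤ[ω]` dividing `p`, the unit being a sextic
residue symbol `(4D/π)₆`).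
For the EXISTENCE statement `a_p = π + π̄`, `N(π) = p` (all that Deuring's theorem in Cox's form
asserts) the precise unit and the cubic reciprocity law are not needed, and the proof given here
is Ireland–Rosen's character-sum count (Ch. 18 §3, PDF p. 298:
"`N(y² = x³ + D) = Σ_{u+v=D} N(y² = u) N(x³ = −v) = Σ_{u+v=D} (1 + ρ(u))(1 + χ(−v) + χ²(−v))`")
stopped before the evaluation `J(χ_π, χ_π) = π` of the Jacobi sum:

1. (`sum_quadraticChar_cube_add`) For a finite field `F` of odd characteristic with a cubic
   character `χ` of order `3` (values in `ℂ`) and `B ≠ 0`,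
   `Σ_x ρ(x³ + B) = c J + \overline{c J}` with `ρ` the quadratic character,
   `J = J(χ, ρ) = Σ_t χ(t) ρ(1 − t)` (Mathlib's `jacobiSum`) and `c = ρ(B) χ(−B)`: substitute
   `#{x : x³ = w} = 1 + χ(w) + χ²(w)` (`card_cube_eq`, Ireland–Rosen Prop. 8.1.5) and `w = −Bt`.
2. `J J̄ = #F` (Mathlib's `jacobiSum_mul_jacobiSum_inv`, with `J̄ = J(χ⁻¹, ρ⁻¹)`), `c c̄ = 1`, and
   `J, c ∈ ℤ[ω]` (the values of `χ` are cube roots of unity, `ω = 1 + ω_{-3} ∈ cmRing (-3)`).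
3. For `W/ℚ` globally minimal with `j(W) = 0` and `p ∤ 6Δ_W`: `c₄ = 0`, so the reduction mod `p`
   in short Weierstrass form (Mathlib's `toShortNF`, same number of `𝔽_p`-points by the tree's
   `VariableChange.pointEquiv`) is `y² = x³ + B`, `B ≠ 0`, and
   `#Ẽ(𝔽_p) = 1 + Σ_x (1 + ρ(x³ + B))` (the tree's `Literature.NumberTheory.EllipticCurves.HasseElementary.natCard_point_eq`,
   `numY_eq`), i.e. `a_p(W) = −Σ_x ρ(x³ + B) = π + π̄` with `π = −cJ`, `ππ̄ = p`.
   A cubic character of order `3` on `𝔽_p` exists because `-3` is a square mod `p` gives a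
   primitive cube root of unity `(r − 1)/2` in `𝔽_p`, so `3 ∣ p − 1` (Mathlib's
   `MulChar.exists_mulChar_orderOf`).

## References

* K. Ireland, M. Rosen, *A Classical Introduction to Modern Number Theory*, 2nd ed., GTM 84
  (1990), Ch. 8 §1 Prop. 8.1.5 (PDF p. 101: `N(xⁿ = a) = Σ_{χⁿ = ε} χ(a)`), Ch. 8 §3 Thm. 1;
  Ch. 18 §3, the count on PDF p. 298 and Thm. 4 (PDF p. 299). Held:
  `book:ireland1982-classical-introduction-modern-number-theory`. [IrelandRosen1990]
* D. A. Cox, *Primes of the form x² + ny²*, 2nd ed. (2013), §14.C: Thm. 14.16, (14.17) and the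
  discussion following it, Exercise 14.13 (PDF pp. 322–324, 337). [Cox2013]
* M. Deuring, Abh. Math. Sem. Univ. Hamburg 14 (1941), 197–272. [Deuring1941]
-/

noncomputable section

open scoped Classical ComplexConjugate

open WeierstrassCurve Complex Finset

namespace Literature.NumberTheory.EllipticCurves

/-! ### Roots of unity in `ℂ` and the order `ℤ[ω] = cmRing (-3)` -/

/-- A complex root of unity `z` (`zⁿ = 1`) has `z̄ = z⁻¹`. [folklore] -/
theorem conj_eq_inv_of_pow_eq_one {z : ℂ} {n : ℕ} (hn : n ≠ 0) (hz : z ^ n = 1) :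
    conj z = z⁻¹ := by
  have hnorm : ‖z‖ = 1 := by
    have h := congrArg norm hz
    rw [norm_pow, norm_one] at h
    exact (pow_eq_one_iff_of_nonneg (norm_nonneg z) hn).mp h
  have hsq : Complex.normSq z = 1 := by
    rw [Complex.normSq_eq_norm_sq, hnorm, one_pow]
  rw [Complex.inv_def, hsq]
  simp

/-- `ω = 1 + ω_{-3} = (-1 + i√3)/2`. [folklore] -/
theorem one_add_cmGen_neg_three :
    1 + cmGen (-3) = (-1 + I * (Real.sqrt 3 : ℂ)) / 2 := by
  rw [cmGen, show (-((-3 : ℤ) : ℝ)) = 3 by norm_num]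
  push_cast
  ring

/-- `ω = (-1 + i√3)/2` is a primitive cube root of unity. [folklore] -/
theorem isPrimitiveRoot_one_add_cmGen : IsPrimitiveRoot (1 + cmGen (-3)) 3 := by
  have hs : ((Real.sqrt 3 : ℝ) : ℂ) ^ 2 = 3 := by
    have h : (Real.sqrt 3) ^ 2 = (3 : ℝ) := Real.sq_sqrt (by norm_num)
    exact_mod_cast h
  have hI2 : I ^ 2 = -1 := Complex.I_sq
  have hspos : (0 : ℝ) < Real.sqrt 3 := Real.sqrt_pos.mpr (by norm_num)
  have him : ((-1 + I * (Real.sqrt 3 : ℂ)) / 2).im = Real.sqrt 3 / 2 := by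
    simp [Complex.div_ofNat_im]
  have him2 : (((-1 + I * (Real.sqrt 3 : ℂ)) / 2) ^ 2).im = -Real.sqrt 3 / 2 := by
    have h2 : ((-1 + I * (Real.sqrt 3 : ℂ)) / 2) ^ 2 = (-1 - I * (Real.sqrt 3 : ℂ)) / 2 := by
      linear_combination (-1 / 4 : ℂ) * hs + ((Real.sqrt 3 : ℂ) ^ 2 / 4) * hI2
    rw [h2]
    simp [Complex.div_ofNat_im]
  rw [one_add_cmGen_neg_three]
  refine IsPrimitiveRoot.mk_of_lt _ (by norm_num) ?_ fun l hl0 hl3 => ?_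
  · linear_combination ((3 - I * (Real.sqrt 3 : ℂ)) / 8) * hs +
      ((-3 * (Real.sqrt 3 : ℂ) ^ 2 + I * (Real.sqrt 3 : ℂ) ^ 3) / 8) * hI2
  · interval_cases l
    · intro h
      rw [pow_one] at h
      have := congrArg Complex.im h
      rw [him, Complex.one_im] at this
      linarith
    · intro h
      have := congrArg Complex.im h
      rw [him2, Complex.one_im] at this
      linarith

/-- `ω ∈ ℤ[ω_{-3}]`. [folklore] -/
theorem one_add_cmGen_mem : 1 + cmGen (-3) ∈ cmRing (-3) :=
  add_mem (one_mem _) (cmGen_mem_cmRing (-3))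

/-- Every complex cube root of unity lies in `ℤ[ω]` (it is a power of `ω`). [folklore] -/
theorem mem_cmRing_of_pow_three_eq_one {z : ℂ} (hz : z ^ 3 = 1) : z ∈ cmRing (-3) := by
  obtain ⟨i, -, rfl⟩ := isPrimitiveRoot_one_add_cmGen.eq_pow_of_pow_eq_one hz
  exact pow_mem one_add_cmGen_mem i

/-! ### Cubic characters: `#{x : x³ = w} = 1 + χ(w) + χ²(w)` (Ireland–Rosen, Prop. 8.1.5) -/

section Cubic

variable {F : Type*} [Field F] {χ : MulChar F ℂ}

/-- For `χ` of order `3` and `a ≠ 0`: `χ(a)³ = 1`. [folklore] -/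
theorem apply_pow_three_eq_one (hχ : orderOf χ = 3) {a : F} (ha : a ≠ 0) : χ a ^ 3 = 1 := by
  rw [← MulChar.pow_apply' χ three_ne_zero, ← hχ, pow_orderOf_eq_one,
    MulChar.one_apply (isUnit_iff_ne_zero.mpr ha)]

/-- The values of a character of order `3` lie in `ℤ[ω]`. [folklore] -/
theorem apply_mem_cmRing (hχ : orderOf χ = 3) (a : F) : χ a ∈ cmRing (-3) := by
  by_cases ha : a = 0
  · rw [ha, MulChar.map_zero]; exact zero_mem _
  · exact mem_cmRing_of_pow_three_eq_one (apply_pow_three_eq_one hχ ha)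

/-- `\overline{χ(a)} = χ⁻¹(a)` for a character of order `3`. [folklore] -/
theorem conj_apply (hχ : orderOf χ = 3) (a : F) : conj (χ a) = χ⁻¹ a := by
  rw [MulChar.inv_apply_eq_inv']
  by_cases ha : a = 0
  · rw [ha, MulChar.map_zero]; simp
  · exact conj_eq_inv_of_pow_eq_one three_ne_zero (apply_pow_three_eq_one hχ ha)

/-- `\overline{χ(a)} = χ(a)²` for a character of order `3`. [folklore] -/
theorem conj_apply_eq_sq (hχ : orderOf χ = 3) (a : F) : conj (χ a) = χ a ^ 2 := by
  by_cases ha : a = 0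
  · rw [ha, MulChar.map_zero]; simp
  · have h3 := apply_pow_three_eq_one hχ ha
    have hz : χ a ≠ 0 := by
      intro h0; rw [h0] at h3; norm_num at h3
    rw [conj_eq_inv_of_pow_eq_one three_ne_zero h3]
    rw [pow_succ, pow_two] at h3
    -- `χ a ^ 2 * χ a = 1`
    exact (eq_inv_of_mul_eq_one_left (by rw [pow_two]; exact h3)).symm

/-- **The kernel of a cubic character is the cubes**: if `χ` has order `3` and `χ(a) = 1`,
`a ≠ 0`, then `a` is a cube (via a generator of the cyclic group `F^×`). [folklore] -/
theorem exists_pow_three_eq_of_apply_eq_one [Fintype F] (hχ : orderOf χ = 3) {a : F} (ha : a ≠ 0)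
    (h1 : χ a = 1) : ∃ b : F, b ^ 3 = a := by
  obtain ⟨g, hg⟩ := IsCyclic.exists_generator (α := Fˣ)
  set z : ℂ := χ (g : F) with hz
  have hz3 : z ^ 3 = 1 := apply_pow_three_eq_one hχ g.ne_zero
  have hz1 : z ≠ 1 := by
    intro hz1
    apply (show χ ≠ 1 by intro h; rw [h, orderOf_one] at hχ; norm_num at hχ)
    refine MulChar.ext fun u => ?_
    obtain ⟨k, rfl⟩ := Subgroup.mem_zpowers_iff.mp (hg u)
    rw [MulChar.one_apply_coe, ← MulChar.coe_toUnitHom, map_zpow, Units.val_zpow_eq_zpow_val,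
      MulChar.coe_toUnitHom, ← hz, hz1, one_zpow]
  have hprim : IsPrimitiveRoot z 3 := by
    refine IsPrimitiveRoot.mk_of_lt z (by norm_num) hz3 fun l hl0 hl3 => ?_
    interval_cases l
    · rwa [pow_one]
    · intro h2
      apply hz1
      have h32 : z ^ 3 = z ^ 2 * z := pow_succ z 2
      rw [hz3, h2, one_mul] at h32
      exact h32.symm
  obtain ⟨k, hk⟩ := Subgroup.mem_zpowers_iff.mp (hg (Units.mk0 a ha))
  have hk' : z ^ k = 1 := by
    rw [hz, ← MulChar.coe_toUnitHom, ← Units.val_zpow_eq_zpow_val, ← map_zpow, hk,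
      MulChar.coe_toUnitHom, Units.val_mk0, h1]
  obtain ⟨m, rfl⟩ := (hprim.zpow_eq_one_iff_dvd k).mp hk'
  refine ⟨((g ^ m : Fˣ) : F), ?_⟩
  rw [← Units.val_pow_eq_pow_val, ← zpow_natCast, ← zpow_mul, mul_comm, hk, Units.val_mk0]


/-- A character of order `3` on a finite field forces a cube root of unity of order `3` in `F^×`
(`3 ∣ #F - 1`, Cauchy). [folklore] -/
theorem exists_orderOf_units_eq_three [Fintype F] (hχ : orderOf χ = 3) : ∃ ω : Fˣ, orderOf ω = 3 := by
  have h3 : 3 ∣ Fintype.card Fˣ := by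
    rw [Fintype.card_units, ← hχ]
    exact MulChar.orderOf_dvd_card_sub_one F χ
  haveI : Fact (Nat.Prime 3) := ⟨Nat.prime_three⟩
  exact exists_prime_orderOf_dvd_card 3 h3

/-- **Ireland–Rosen, Prop. 8.1.5 for cubes**: `#{x ∈ F : x³ = w} = 1 + χ(w) + χ(w)²` for a
character `χ` of order `3`. [cite: IrelandRosen1990, Ch. 8 §1, Prop. 8.1.5 (PDF p. 101)] -/
theorem card_cube_eq [Fintype F] (hχ : orderOf χ = 3) (w : F) :
    ((univ.filter fun x : F => x ^ 3 = w).card : ℂ) = 1 + χ w + χ w ^ 2 := by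
  obtain ⟨ω, hω⟩ := exists_orderOf_units_eq_three hχ
  have hω3 : (ω : F) ^ 3 = 1 := by
    rw [← Units.val_pow_eq_pow_val, ← hω, pow_orderOf_eq_one, Units.val_one]
  have hω1 : (ω : F) ≠ 1 := by
    intro h
    have : ω = 1 := Units.ext h
    rw [this, orderOf_one] at hω
    norm_num at hω
  have hω2 : (ω : F) ^ 2 ≠ 1 := by
    intro h
    have h' : ω ^ 2 = 1 := Units.ext (by rw [Units.val_pow_eq_pow_val]; exact h)
    have := orderOf_dvd_of_pow_eq_one h'
    rw [hω] at this
    norm_num at this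
  have hquad : (ω : F) ^ 2 + ω + 1 = 0 := by
    have h : ((ω : F) - 1) * ((ω : F) ^ 2 + ω + 1) = 0 := by linear_combination hω3
    rcases mul_eq_zero.mp h with h | h
    · exact absurd (sub_eq_zero.mp h) hω1
    · exact h
  have hroots : ∀ y : F, y ^ 3 = 1 ↔ y = 1 ∨ y = ω ∨ y = (ω : F) ^ 2 := by
    intro y
    constructor
    · intro hy
      have h : (y - 1) * (y - ω) * (y - (ω : F) ^ 2) = 0 := by
        linear_combination hy - (y ^ 2 - y) * hquad + (y - 1) * hω3
      rcases mul_eq_zero.mp h with h | h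
      · rcases mul_eq_zero.mp h with h | h
        · exact Or.inl (sub_eq_zero.mp h)
        · exact Or.inr (Or.inl (sub_eq_zero.mp h))
      · exact Or.inr (Or.inr (sub_eq_zero.mp h))
    · rintro (rfl | rfl | rfl)
      · exact one_pow 3
      · exact hω3
      · rw [← pow_mul, show 2 * 3 = 3 * 2 by norm_num, pow_mul, hω3, one_pow]
  by_cases hw : w = 0
  · subst hw
    have hset : (univ.filter fun x : F => x ^ 3 = 0) = {0} := by
      ext x
      simp
    rw [hset, card_singleton, MulChar.map_zero]
    norm_num
  by_cases h1 : χ w = 1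
  · obtain ⟨b, rfl⟩ := exists_pow_three_eq_of_apply_eq_one hχ hw h1
    have hb : b ≠ 0 := by
      rintro rfl
      exact hw (by simp)
    have hset : (univ.filter fun x : F => x ^ 3 = b ^ 3) = {b, b * ω, b * (ω : F) ^ 2} := by
      ext x
      simp only [mem_filter, mem_univ, true_and, mem_insert, mem_singleton]
      have e : x ^ 3 = b ^ 3 ↔ (x / b) ^ 3 = 1 := by
        rw [div_pow, div_eq_one_iff_eq (pow_ne_zero 3 hb)]
      rw [e, hroots (x / b), div_eq_iff hb, div_eq_iff hb, div_eq_iff hb, one_mul, mul_comm (ω : F) b,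
        mul_comm ((ω : F) ^ 2) b]
    have hne1 : b ≠ b * ω := by
      intro h
      exact hω1 ((mul_right_eq_self₀.mp h.symm).resolve_right hb)
    have hne2 : b ≠ b * (ω : F) ^ 2 := by
      intro h
      exact hω2 ((mul_right_eq_self₀.mp h.symm).resolve_right hb)
    have hne3 : b * ω ≠ b * (ω : F) ^ 2 := by
      intro h
      have h' : (ω : F) = (ω : F) ^ 2 := mul_left_cancel₀ hb h
      apply hω1
      have h'' : (ω : F) * ((ω : F) - 1) = 0 := by linear_combination (-1 : F) * h'
      rcases mul_eq_zero.mp h'' with h0 | h0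
      · exact absurd h0 ω.ne_zero
      · exact sub_eq_zero.mp h0
    rw [hset, Finset.card_eq_three.mpr ⟨b, b * ω, b * (ω : F) ^ 2, hne1, hne2, hne3, rfl⟩, h1]
    norm_num
  · have hset : (univ.filter fun x : F => x ^ 3 = w) = ∅ := by
      ext x
      simp only [mem_filter, mem_univ, true_and, Finset.notMem_empty, iff_false]
      intro hx
      apply h1
      have hx0 : x ≠ 0 := by
        rintro rfl
        exact hw (by rw [← hx]; simp)
      rw [← hx, map_pow, apply_pow_three_eq_one hχ hx0]
    rw [hset, card_empty]
    have hz3 := apply_pow_three_eq_one hχ hw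
    have h : (χ w - 1) * (1 + χ w + χ w ^ 2) = 0 := by linear_combination hz3
    rcases mul_eq_zero.mp h with h | h
    · exact absurd (sub_eq_zero.mp h) h1
    · rw [h]; norm_num

/-- `Σ_x f(x³) = Σ_w (1 + χ(w) + χ(w)²) f(w)` (sum over the fibres of `x ↦ x³`). [folklore] -/
theorem sum_comp_pow_three [Fintype F] (hχ : orderOf χ = 3) (f : F → ℂ) :
    ∑ x : F, f (x ^ 3) = ∑ w : F, (1 + χ w + χ w ^ 2) * f w := by
  rw [← Finset.sum_fiberwise' univ (fun x : F => x ^ 3) f]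
  refine sum_congr rfl fun w _ => ?_
  rw [sum_const, nsmul_eq_mul, card_cube_eq hχ w]

/-- The quadratic character with complex values is not trivial (odd characteristic). [folklore] -/
theorem quadraticChar_ringHomComp_ne_one [Fintype F] [DecidableEq F] (hF : ringChar F ≠ 2) :
    (quadraticChar F).ringHomComp (Int.castRingHom ℂ) ≠ 1 := by
  obtain ⟨a, ha⟩ := quadraticChar_exists_neg_one hF
  intro h
  have ha0 : a ≠ 0 := by
    rintro rfl
    rw [quadraticChar_zero] at ha
    norm_num at ha
  have := congrArg (fun ψ : MulChar F ℂ => ψ a) h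
  simp only [MulChar.ringHomComp_apply, ha, MulChar.one_apply (isUnit_iff_ne_zero.mpr ha0)] at this
  norm_num at this

/-- The values of the complex quadratic character are `0, 1, -1`; in particular they are fixed by
complex conjugation and by inversion. [folklore] -/
theorem conj_quadraticChar_ringHomComp [Fintype F] [DecidableEq F] (a : F) :
    conj ((quadraticChar F).ringHomComp (Int.castRingHom ℂ) a) =
      (quadraticChar F).ringHomComp (Int.castRingHom ℂ) a ∧
    ((quadraticChar F).ringHomComp (Int.castRingHom ℂ) a)⁻¹ =
      (quadraticChar F).ringHomComp (Int.castRingHom ℂ) a := by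
  rw [MulChar.ringHomComp_apply, eq_intCast, map_intCast]
  refine ⟨rfl, ?_⟩
  by_cases ha : a = 0
  · rw [ha, quadraticChar_zero]; simp
  · rcases quadraticChar_dichotomy ha with h | h <;> rw [h] <;> norm_num

/-- **`Σ_x ρ(x³ + B) = cJ + \overline{cJ}`** for the quadratic character `ρ`, a cubic character
`χ` of order `3`, `B ≠ 0`, with `J = J(χ, ρ)` the Jacobi sum and `c = ρ(B)χ(−B)` (Ireland–Rosen,
Ch. 8 §3–4 / Ch. 18 §3: count `y² = x³ + B` through `#{x³ = w} = 1 + χ(w) + χ²(w)` and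
`w = −Bt`). [cite: IrelandRosen1990, Ch. 18 §3, proof of Thm. 4 (PDF p. 298)] -/
theorem sum_quadraticChar_cube_add [Fintype F] [DecidableEq F] (hF : ringChar F ≠ 2)
    (hχ : orderOf χ = 3) {B : F} (hB : B ≠ 0) :
    ∑ x : F, (quadraticChar F).ringHomComp (Int.castRingHom ℂ) (x ^ 3 + B) =
      (quadraticChar F).ringHomComp (Int.castRingHom ℂ) B * χ (-B) *
          jacobiSum χ ((quadraticChar F).ringHomComp (Int.castRingHom ℂ)) +
        conj ((quadraticChar F).ringHomComp (Int.castRingHom ℂ) B * χ (-B) *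
          jacobiSum χ ((quadraticChar F).ringHomComp (Int.castRingHom ℂ))) := by
  set ρ : MulChar F ℂ := (quadraticChar F).ringHomComp (Int.castRingHom ℂ) with hρ
  -- `T1 = Σ_w χ(w) ρ(w + B) = c J`
  have hT1 : ∑ w : F, χ w * ρ (w + B) = ρ B * χ (-B) * jacobiSum χ ρ := by
    have hB' : -B ≠ 0 := neg_ne_zero.mpr hB
    rw [← Fintype.sum_equiv (Equiv.mulLeft₀ (-B) hB') (fun t => χ (-B * t) * ρ (-B * t + B))
      (fun w => χ w * ρ (w + B)) (fun t => rfl)]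
    unfold jacobiSum
    rw [mul_sum]
    refine sum_congr rfl fun t _ => ?_
    rw [show -B * t + B = B * (1 - t) by ring, map_mul, map_mul]
    ring
  -- `T2 = Σ_w χ(w)² ρ(w + B) = conj T1`
  have hT2 : ∑ w : F, χ w ^ 2 * ρ (w + B) = conj (∑ w : F, χ w * ρ (w + B)) := by
    rw [map_sum]
    refine sum_congr rfl fun w _ => ?_
    rw [map_mul, conj_apply_eq_sq hχ, (conj_quadraticChar_ringHomComp (w + B)).1]
  -- `T0 = Σ_w ρ(w + B) = 0`
  have hT0 : ∑ w : F, ρ (w + B) = 0 := by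
    rw [Fintype.sum_equiv (Equiv.addRight B) (fun w => ρ (w + B)) ρ (fun w => rfl)]
    exact MulChar.sum_eq_zero_of_ne_one (quadraticChar_ringHomComp_ne_one hF)
  calc ∑ x : F, ρ (x ^ 3 + B) = ∑ x : F, (fun w => ρ (w + B)) (x ^ 3) := rfl
    _ = ∑ w : F, (1 + χ w + χ w ^ 2) * (fun w => ρ (w + B)) w :=
        sum_comp_pow_three hχ (fun w => ρ (w + B))
    _ = ∑ w : F, ρ (w + B) + ∑ w : F, χ w * ρ (w + B) + ∑ w : F, χ w ^ 2 * ρ (w + B) := by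
      rw [← sum_add_distrib, ← sum_add_distrib]
      refine sum_congr rfl fun w _ => ?_
      simp only
      ring
    _ = _ := by rw [hT0, hT2, hT1, zero_add]

/-- **`J(χ, ρ) \overline{J(χ, ρ)} = #F`** for `χ` of order `3` and `ρ` the quadratic character
(Mathlib's `jacobiSum_mul_jacobiSum_inv`, with `\overline{J(χ, ρ)} = J(χ⁻¹, ρ⁻¹)`).
Ireland–Rosen, Ch. 8 §3, Thm. 1(d). [cite: IrelandRosen1990, Ch. 8 §3, Thm. 1] -/
theorem jacobiSum_mul_conj [Fintype F] [DecidableEq F] (hF : ringChar F ≠ 2)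
    (hχ : orderOf χ = 3) :
    jacobiSum χ ((quadraticChar F).ringHomComp (Int.castRingHom ℂ)) *
        conj (jacobiSum χ ((quadraticChar F).ringHomComp (Int.castRingHom ℂ))) =
      Fintype.card F := by
  set ρ : MulChar F ℂ := (quadraticChar F).ringHomComp (Int.castRingHom ℂ) with hρ
  have hconj : conj (jacobiSum χ ρ) = jacobiSum χ⁻¹ ρ⁻¹ := by
    unfold jacobiSum
    rw [map_sum]
    refine sum_congr rfl fun t _ => ?_
    rw [map_mul, conj_apply hχ, (conj_quadraticChar_ringHomComp (1 - t)).1,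
      MulChar.inv_apply_eq_inv' ρ, (conj_quadraticChar_ringHomComp (1 - t)).2]
  have hchar : ringChar ℂ ≠ ringChar F := by
    rw [ringChar.eq_zero]
    exact (CharP.char_ne_zero_of_finite F (ringChar F)).symm
  have hχ1 : χ ≠ 1 := by
    intro h
    rw [h, orderOf_one] at hχ
    norm_num at hχ
  have hρ1 : ρ ≠ 1 := quadraticChar_ringHomComp_ne_one hF
  have hχρ : χ * ρ ≠ 1 := by
    intro h
    have hρ2 : ρ ^ 2 = 1 := ((quadraticChar_isQuadratic F).comp (Int.castRingHom ℂ)).sq_eq_one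
    have hχ2 : χ ^ 2 = 1 := by
      have : χ = ρ⁻¹ := eq_inv_of_mul_eq_one_left h
      rw [this, inv_pow, hρ2, inv_one]
    have := orderOf_dvd_of_pow_eq_one hχ2
    rw [hχ] at this
    norm_num at this
  rw [hconj]
  exact jacobiSum_mul_jacobiSum_inv hchar hχ1 hρ1 hχρ

/-- `J(χ, ρ) ∈ ℤ[ω]` for `χ` of order `3` and `ρ` the quadratic character. [folklore] -/
theorem jacobiSum_mem_cmRing [Fintype F] [DecidableEq F] (hχ : orderOf χ = 3) :
    jacobiSum χ ((quadraticChar F).ringHomComp (Int.castRingHom ℂ)) ∈ cmRing (-3) := by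
  unfold jacobiSum
  refine sum_mem fun t _ => mul_mem (apply_mem_cmRing hχ t) ?_
  rw [MulChar.ringHomComp_apply, eq_intCast]
  exact intCast_mem _ _

end Cubic

/-! ### The `j = 0` case of Deuring's theorem -/

/-- **Deuring's `a_p = π + π̄` for `j = 0`, proved** (the body of
`Deuring1941_frobeniusTrace_eq_add_conj` under `W.j = 0`; Cox, Thm. 14.16 with (14.17) ff.:
this case is Gauss's; Ireland–Rosen, Ch. 18 §3 Thm. 4): for a globally minimal `W/ℚ` with
`j(W) = 0`, an odd prime `p ∤ Δ_W` with `p ∤ -3` and `-3` a square mod `p`, there is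
`π ∈ ℤ[ω_{-3}] = ℤ[ω]` with `ππ̄ = p` and `a_p(W) = π + π̄`: `π = −ρ(B)χ(−B) J(χ, ρ)` for the
short model `y² = x³ + B` of the reduction and a cubic character `χ` of order `3` on `𝔽_p`.
[cite: IrelandRosen1990, Ch. 18 §3, Theorem 4 and its proof (PDF pp. 298–299)]
[cite: Cox2013, Thm. 14.16 with (14.17) ff. (§14.C, PDF pp. 322–324)] -/
theorem Deuring1941_frobeniusTrace_eq_add_conj_of_j_eq_zero (W : WeierstrassCurve ℚ)
    [W.IsElliptic] [W.IsGloballyMinimal] (hj : W.j = 0) (p : ℕ) (hp : p.Prime) (h2 : p ≠ 2)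
    (hΔ : ¬ (p : ℤ) ∣ minimalDiscriminantInt W) (hd : ¬ (p : ℤ) ∣ cmDiscr W.j)
    (hsplit : IsSquare ((cmDiscr W.j : ℤ) : ZMod p)) :
    ∃ π : ℂ, π ∈ cmRing (cmDiscr W.j) ∧ π * conj π = p ∧
      (W.frobeniusTrace p : ℂ) = π + conj π := by
  haveI : Fact p.Prime := ⟨hp⟩
  have hd3 : cmDiscr W.j = -3 := by rw [hj]; norm_num [cmDiscr]
  rw [hd3] at hsplit hd ⊢
  have h3 : p ≠ 3 := by
    rintro rfl
    exact hd (by norm_num)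
  have h2' : (2 : ZMod p) ≠ 0 := by
    intro h0
    have h0' : ((2 : ℕ) : ZMod p) = 0 := by exact_mod_cast h0
    rw [ZMod.natCast_eq_zero_iff] at h0'
    exact h2 ((Nat.prime_dvd_prime_iff_eq hp Nat.prime_two).mp h0')
  have h3' : (3 : ZMod p) ≠ 0 := by
    intro h0
    have h0' : ((3 : ℕ) : ZMod p) = 0 := by exact_mod_cast h0
    rw [ZMod.natCast_eq_zero_iff] at h0'
    exact h3 ((Nat.prime_dvd_prime_iff_eq hp Nat.prime_three).mp h0')
  -- a primitive cube root of unity in `𝔽_p`, hence `3 ∣ p - 1` and a cubic character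
  obtain ⟨r, hr⟩ := hsplit
  have hr' : r ^ 2 = -3 := by
    rw [sq, ← hr]; push_cast; ring
  have hquad : ((r - 1) * 2⁻¹) ^ 2 + (r - 1) * 2⁻¹ + 1 = (0 : ZMod p) := by
    have h4 : (2 : ZMod p) * 2⁻¹ = 1 := mul_inv_cancel₀ h2'
    linear_combination (2⁻¹ : ZMod p) ^ 2 * hr' + (-1 - (1 + r) * 2⁻¹) * h4
  set ω : ZMod p := (r - 1) * 2⁻¹ with hω
  have hω3 : ω ^ 3 = 1 := by linear_combination (ω - 1) * hquad
  have hω1 : ω ≠ 1 := by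
    intro h
    rw [h] at hquad
    apply h3'
    linear_combination hquad
  have hω0 : ω ≠ 0 := by
    intro h
    rw [h] at hquad
    norm_num at hquad
  have hdvd : 3 ∣ Fintype.card (ZMod p) - 1 := by
    have hu : orderOf (Units.mk0 ω hω0) = 3 := by
      refine orderOf_eq_prime (Units.ext ?_) fun h => hω1 ?_
      · rw [Units.val_pow_eq_pow_val, Units.val_mk0, hω3, Units.val_one]
      · have := congrArg Units.val h
        rwa [Units.val_mk0, Units.val_one] at this
    rw [← Fintype.card_units, ← hu]
    exact orderOf_dvd_card
  obtain ⟨χ, hχ⟩ := MulChar.exists_mulChar_orderOf (ZMod p) hdvd isPrimitiveRoot_one_add_cmGen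
  -- the reduction `Ẽ` and its short model `y² = x³ + B`
  haveI hE : (reductionModPrime W p).IsElliptic := isElliptic_reductionModPrime W hΔ
  have hc4 : (reductionModPrime W p).c₄ = 0 := by
    have h0 : W.c₄ = 0 := W.j_eq_zero_iff.mp hj
    have hc : ((integralModelInt W).c₄ : ℚ) = W.c₄ := by
      have h := (integralModelInt W).map_c₄ (Int.castRingHom ℚ)
      rw [map_integralModelInt, eq_intCast] at h
      exact h.symm
    have hint : (integralModelInt W).c₄ = 0 := by exact_mod_cast hc.trans h0
    show ((integralModelInt W).map (Int.castRingHom (ZMod p))).c₄ = 0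
    rw [map_c₄, hint, map_zero]
  haveI : Invertible (2 : ZMod p) := invertibleOfNonzero h2'
  haveI : Invertible (3 : ZMod p) := invertibleOfNonzero h3'
  set C := (reductionModPrime W p).toShortNF with hC
  have ha4 : (C • reductionModPrime W p).a₄ = 0 := by
    have h := (C • reductionModPrime W p).c₄_of_isShortNF
    rw [variableChange_c₄, hc4, mul_zero] at h
    have h48 : (-48 : ZMod p) ≠ 0 := by
      rw [show (-48 : ZMod p) = -(2 ^ 4 * 3) by norm_num]
      exact neg_ne_zero.mpr (mul_ne_zero (pow_ne_zero _ h2') h3')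
    exact (mul_eq_zero.mp h.symm).resolve_left h48
  set B := (C • reductionModPrime W p).a₆ with hB
  have hB0 : B ≠ 0 := by
    intro h0
    have hΔ0 : (C • reductionModPrime W p).Δ = 0 := by
      rw [(C • reductionModPrime W p).Δ_of_isShortNF, ha4, ← hB, h0]; ring
    exact (C • reductionModPrime W p).Δ'.ne_zero (by rw [coe_Δ']; exact hΔ0)
  -- `#Ẽ(𝔽_p) = 1 + Σ_x (ρ(x³ + B) + 1)`, so `a_p = -Σ_x ρ(x³ + B)`
  have hpF : ringChar (ZMod p) ≠ 2 := by rw [ZMod.ringChar_zmod_n]; exact h2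
  have hcount : (reductionPointCount W p : ℤ) =
      1 + ∑ x : ZMod p, ((quadraticChar (ZMod p) (x ^ 3 + B) : ℤ) + 1) := by
    rw [reductionPointCount_eq_natCard_point,
      Nat.card_congr (VariableChange.pointEquiv (reductionModPrime W p) C).toEquiv,
      Literature.NumberTheory.EllipticCurves.HasseElementary.natCard_point_eq]
    push_cast
    congr 1
    refine sum_congr rfl fun x _ => ?_
    rw [Literature.NumberTheory.EllipticCurves.HasseElementary.numY_eq _ hpF, Literature.NumberTheory.EllipticCurves.HasseElementary.eval_cubic, ha4, ← hB, zero_mul,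
      add_zero]
    -- (the two sides differ only in the `DecidableEq` instance hidden in `quadraticChar`)
    congr!
  have hft : (W.frobeniusTrace p : ℤ) = -∑ x : ZMod p, (quadraticChar (ZMod p) (x ^ 3 + B) : ℤ) := by
    rw [frobeniusTrace, hcount, sum_add_distrib, sum_const, card_univ, ZMod.card p]
    ring
  -- the character sum
  set ρ : MulChar (ZMod p) ℂ := (quadraticChar (ZMod p)).ringHomComp (Int.castRingHom ℂ) with hρ
  have key := sum_quadraticChar_cube_add hpF hχ hB0
  have hnorm := jacobiSum_mul_conj hpF hχ
  rw [← hρ] at key hnorm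
  set c : ℂ := ρ B * χ (-B) with hc
  set J : ℂ := jacobiSum χ ρ with hJ
  have hcc : c * conj c = 1 := by
    have hz3 : χ (-B) ^ 3 = 1 := apply_pow_three_eq_one hχ (neg_ne_zero.mpr hB0)
    have hz0 : χ (-B) ≠ 0 := by
      intro h0; rw [h0] at hz3; norm_num at hz3
    have hχc : χ (-B) * conj (χ (-B)) = 1 := by
      rw [conj_eq_inv_of_pow_eq_one three_ne_zero hz3, mul_inv_cancel₀ hz0]
    have hρc : ρ B * conj (ρ B) = 1 := by
      rw [(conj_quadraticChar_ringHomComp B).1, hρ, MulChar.ringHomComp_apply, eq_intCast]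
      rcases quadraticChar_dichotomy hB0 with h | h <;> rw [h] <;> norm_num
    rw [hc, map_mul]
    linear_combination conj (ρ B) * ρ B * hχc + hρc
  refine ⟨-(c * J), ?_, ?_, ?_⟩
  · refine neg_mem (mul_mem (mul_mem ?_ (apply_mem_cmRing hχ _)) (jacobiSum_mem_cmRing hχ))
    rw [hρ, MulChar.ringHomComp_apply, eq_intCast]
    exact intCast_mem _ _
  · rw [map_neg, neg_mul_neg, map_mul]
    calc c * J * (conj c * conj J) = (c * conj c) * (J * conj J) := by ring
      _ = (Fintype.card (ZMod p) : ℂ) := by rw [hcc, hnorm, one_mul]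
      _ = p := by rw [ZMod.card]
  · have hC : (W.frobeniusTrace p : ℂ) = -∑ x : ZMod p, ρ (x ^ 3 + B) := by
      rw [show (W.frobeniusTrace p : ℂ) = ((W.frobeniusTrace p : ℤ) : ℂ) from rfl, hft]
      push_cast
      simp only [hρ, MulChar.ringHomComp_apply, eq_intCast]
    rw [hC, key, map_neg]
    ring

end Literature.NumberTheory.EllipticCurves
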